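import Summits.QuantumFields.QCD.Theorems.PauliWegnerSeaPhaseQuenchedFlavourDecayPionSecondMomentOfCrux
import Summits.QuantumFields.QCD.Theorems.PauliWegnerSeaGluonicCompletionDetNonvanishing
import Literature.MathematicalPhysics.QuantumFieldTheory.QCDPhaseQuenchedPositivity

/-!
# Crux `ChiralMobilityGap` (stmt-QuantumFields-17497), line `Sketch`, stub B `stub_pionSigned`:
# the SIGNED connected correlator of the flavoured pseudoscalar pair

Wick contraction in the honest (signed-determinant) lattice-QCD functional `qcdTorusExpect`.
For `A = (ψ̄_g γ₅ ψ_f)(0)`, `B = (ψ̄_f γ₅ ψ_g)(n e₀)` with `f ≠ g` and degenerate bare masses `m_f = m_g`,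
on the torus of side `2S+1`:
`⟨A · τ_{n e₀}B⟩^conn = −∫ det D · X dμ_W / ∫ det D dμ_W`, `X(U) = Σ_{a,i,b,j} |G_f(U)((0,a,i),(n e₀,b,j))|²`.

Proof.
* `A` is `U(1)_f`-charged (`isFlavourCharged_pseudoscalarDensityObs_single`), so the disconnected part
  vanishes and the connected correlator is the full one (`IsFlavourCharged.qcdLatticeConnectedCorr_eq`).
* The fermionic partition function in the background `U` is `ε · det D(U)` with the universal Berezin
  orientation sign `ε ≠ 0` (`fermiIntegral_fermiBoltzmann`, `fermiOrientationSign_ne_zero`), and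
  `det D(U) ≠ 0` for `μ_W`-a.e. `U` (`FiniteSignBudgetAtTheSchemeVolume.stub_detNonvanishing`, seeded by
  the constant twisted field `det_diracMatrix_twistCfg_ne_zero`).
* On that full-measure set the numerator is `(ratio) · ε det D = −X(U) · ε det D` by the configuration-wise
  Wick contraction `pionPair_fermiRatio_eq`; the constant `ε` is pulled out of both integrals and cancels.
-/

noncomputable section

namespace Summit.QuantumFields.QCD.Theorems.ChiralMobilityGapSketch

open scoped BigOperators Topology
open MeasureTheory Filter Set
open Literature.MathematicalPhysics.QuantumFieldTheory Literature.MathematicalPhysics.QuantumLattice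
  Literature.Probability.LatticeModels
open Summit.QuantumFields.QCD.Cruxes.PhaseQuenchedFlavourDecay.CrossingSplitIntegrability
  (pionPair_fermiRatio_eq isFlavourCharged_pseudoscalarDensityObs_single pseudoscalarDensityObs_single_onTorus)

/-- STUB B (Wick, signed functional). **The SIGNED connected correlator of the flavoured pseudoscalar pair**
`A = (ψ̄_g γ₅ ψ_f)(0)`, `B = (ψ̄_f γ₅ ψ_g)(n e₀)`, `f ≠ g`, at a mass tuple with `m_f = m_g`, on the torus of
side `2S+1`: `⟨A · τ_{n e₀}B⟩^conn = −∫ det D · X dμ_W / ∫ det D dμ_W` with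
`X(U) = Σ_{a,i,b,j} |G_f(U)((0,a,i),(n e₀,b,j))|²` (charged ⇒ connected = full; Wick `pionPair_fermiRatio_eq`
configuration-wise; `det D ≠ 0` `μ_W`-a.e. by `stub_detNonvanishing`; the Berezin orientation sign cancels). -/
theorem stub_pionSigned :
    ∀ {Nf : ℕ} (β : ℝ) (S : ℕ) (mq : Fin Nf → ℝ) (f g : Fin Nf), f ≠ g → mq f = mq g → ∀ n : ℕ,
      qcdLatticeConnectedCorr β (2 * S + 1) mq (pseudoscalarDensityObs Nf (Matrix.single g f (1 : ℂ)))
          (pseudoscalarDensityObs Nf (Matrix.single f g (1 : ℂ))) n =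
        -((∫ U : GaugeConfig 4 (2 * S + 1) SU3, (diracMatrix U mq).det *
              ((∑ a : Fin 3, ∑ i : Fin 4, ∑ b : Fin 3, ∑ j : Fin 4,
                ‖(diracMatrix U mq)⁻¹ (quarkEquiv (f, (Torus.proj (2 * S + 1) 0, a, i)))
                  (quarkEquiv (f, (Torus.proj (2 * S + 1) (Pi.single 0 (n : ℤ)), b, j)))‖ ^ (2 : ℕ) : ℝ) : ℂ)
              ∂(wilsonMeasure (fundamentalRep (Fin 3)) β)) /
          (∫ U : GaugeConfig 4 (2 * S + 1) SU3, (diracMatrix U mq).det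
              ∂(wilsonMeasure (fundamentalRep (Fin 3)) β))) := by
  intro Nf β S mq f g hfg hm n
  rw [(isFlavourCharged_pseudoscalarDensityObs_single hfg).qcdLatticeConnectedCorr_eq one_ne_zero]
  unfold qcdTorusExpect
  -- the Berezin orientation sign
  set ε : ℂ := (-1 : ℂ) ^ (Fintype.card (FermiIdx Nf (2 * S + 1)) *
      (Fintype.card (FermiIdx Nf (2 * S + 1)) - 1) / 2 + Fintype.card (FermiIdx Nf (2 * S + 1))) with hεdef
  have hε : ε ≠ 0 := fermiOrientationSign_ne_zero _
  -- `det D ≠ 0` for `μ_W`-a.e. `U`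
  have hae := FiniteSignBudgetAtTheSchemeVolume.stub_detNonvanishing Nf (2 * S + 1) β mq
    ⟨TwistedFreeWilson.twistCfg (2 * S + 1), det_diracMatrix_twistCfg_ne_zero mq⟩
  -- numerator, a.e.: Wick contraction times the fermionic partition function
  have hnum : (fun U : GaugeConfig 4 (2 * S + 1) SU3 =>
      fermiIntegral ((pseudoscalarDensityObs Nf (Matrix.single g f (1 : ℂ))).onTorus (2 * S + 1) 0 U *
          (pseudoscalarDensityObs Nf (Matrix.single f g (1 : ℂ))).onTorus (2 * S + 1)
            (Pi.single 0 (n : ℤ)) U * fermiBoltzmann U mq))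
      =ᵐ[wilsonMeasure (d := 4) (L := 2 * S + 1) (fundamentalRep (Fin 3)) β]
      fun U => ε * -((diracMatrix U mq).det *
        ((∑ a : Fin 3, ∑ i : Fin 4, ∑ b : Fin 3, ∑ j : Fin 4,
          ‖(diracMatrix U mq)⁻¹ (quarkEquiv (f, (Torus.proj (2 * S + 1) 0, a, i)))
            (quarkEquiv (f, (Torus.proj (2 * S + 1) (Pi.single 0 (n : ℤ)), b, j)))‖ ^ (2 : ℕ) : ℝ) : ℂ)) := by
    filter_upwards [hae] with U hU
    have hZ : fermiIntegral (fermiBoltzmann U mq) ≠ 0 := by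
      rw [fermiIntegral_fermiBoltzmann]; exact mul_ne_zero hε hU
    rw [← div_mul_cancel₀ (fermiIntegral (_ * fermiBoltzmann U mq)) hZ,
      pseudoscalarDensityObs_single_onTorus, pseudoscalarDensityObs_single_onTorus,
      pionPair_fermiRatio_eq U mq hfg hm, fermiIntegral_fermiBoltzmann]
    ring
  -- denominator, pointwise
  have hden : (fun U : GaugeConfig 4 (2 * S + 1) SU3 => fermiIntegral (fermiBoltzmann U mq)) =
      fun U => ε * (diracMatrix U mq).det :=
    funext fun U => fermiIntegral_fermiBoltzmann U mq
  rw [integral_congr_ae hnum, hden, integral_const_mul, integral_const_mul, integral_neg,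
    mul_div_mul_left _ _ hε, neg_div]

end Summit.QuantumFields.QCD.Theorems.ChiralMobilityGapSketch

end
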